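import Summits.QuantumFields.GaugeBoot.DiagonalRPTorusNegative
import Literature.RepresentationTheory.CompactGroups.UnitaryTrick
import HarnessLib

/-!
# Diagonal RP on the two-dimensional torus, I: geometry of the swap (gauge-boot, task L3(δ))

HONEST FRAMING (cell `pub-gaugeboot`, page 1 of every file): the venture produces certified bounds
on lattice expectations at stated coupling, gauge group, dimension and torus size; NOT a mass gap,
NOT a continuum limit, NOT a string tension; NOT Yang–Mills-summit-bearing (barriers
`FixedCouplingUltralocality`, `PerturbativeInvisibility`). This module is part of a small NEGATIVE
result about which positivity constraints a TORUS certificate may use; it discharges nothing else.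

Combinatorial groundwork for `DiagonalRPTorusNegativeTwo.lean` (failure of closed-half-space
diagonal reflection positivity on the square torus `(ℤ/L)²`, `L` even `≥ 4`, `β ≠ 0`): the diagonal
coordinate `k = y_i - y_j` under steps and under the swap `θ` (`kd`); the two transports
`C_y = U(y,i) U(y+e_i,j)`, `D_y = U(y,j) U(y+e_j,i)` of a plaquette, with `C_y(ΘU) = D_{θy}(U)`,
`D_y(ΘU) = C_{θy}(U)`, `Re tr ρ(U_p) = Re tr ρ(C_y D_y⁻¹)` (`cT`, `dT`, `rr`, `plaqRe_eq_rr`,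
`wilsonAction_eq_sum_rr`); the back-layer value `c = L/2` (`cc`) and representative arithmetic in
`ZMod L`; the four links of a plaquette (`blk`) and disjointness of the blocks of non-adjacent
plaquettes (`disjoint_blk`); the partition of the plaquettes into mirror `k = 0`, back layer
`k = c` and the interiors of the two halves (`S0`, `Sc`, `Sp`, `Sm`, `sum_split`), the swap
bijection `Sp → Sm` (`sum_Sp_swap`), and the links of the closed half (`InHalf`, `inHalf_dT_links`,
`inHalf_blk`). All statements are proved.
-/

open MeasureTheory Complex Finset Function
open scoped ComplexOrder ENNReal

namespace Summit.QuantumFields.GaugeBoot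

open Literature.MathematicalPhysics.QuantumFieldTheory
open Literature.RepresentationTheory.CompactGroups

noncomputable section

namespace DiagRPTwo
/-! ## Geometry of the two-dimensional torus relative to the diagonal swap -/

section Geometry

variable {L : ℕ}

/-- The diagonal coordinate `k_{ij}(y) = y_i - y_j`. -/
def kd (i j : Fin 2) (y : Site 2 L) : ZMod L := y i - y j

/-- A step in direction `i` raises `k` by one. -/
theorem kd_shift_left {i j : Fin 2} (hij : i ≠ j) (y : Site 2 L) :
    kd i j (y.shift i) = kd i j y + 1 := by
  simp only [kd, WilsonRP.shift_apply_self, WilsonRP.shift_apply_of_ne y hij.symm]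
  ring

/-- A step in direction `j` lowers `k` by one. -/
theorem kd_shift_right {i j : Fin 2} (hij : i ≠ j) (y : Site 2 L) :
    kd i j (y.shift j) = kd i j y - 1 := by
  simp only [kd, WilsonRP.shift_apply_self, WilsonRP.shift_apply_of_ne y hij]
  ring

/-- The swap negates `k`. -/
theorem kd_siteDiagSwap (i j : Fin 2) (y : Site 2 L) :
    kd i j (siteDiagSwap i j y) = -kd i j y := by
  simp only [kd, siteDiagSwap, Equiv.swap_apply_left, Equiv.swap_apply_right]
  ring

/-- A site of the two-dimensional torus fixed by the swap lies on the mirror `k = 0`. -/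
theorem kd_eq_zero_of_siteDiagSwap_eq {i j : Fin 2} (y : Site 2 L) (h : siteDiagSwap i j y = y) :
    kd i j y = 0 := by
  have h1 := congrFun h i
  simp only [siteDiagSwap, Equiv.swap_apply_left] at h1
  simp [kd, h1]

end Geometry

/-! ## The two transports around a plaquette and their behaviour under the swap -/

section Transports

variable {L : ℕ} {G : Type*} [Group G]

/-- `C_y(U) = U(y,i) U(y+e_i,j)`: transport from `y` to `y + e_i + e_j`, direction `i` first. -/
def cT (i j : Fin 2) (U : GaugeConfig 2 L G) (y : Site 2 L) : G := U (y, i) * U (y.shift i, j)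

/-- `D_y(U) = U(y,j) U(y+e_j,i)`: transport from `y` to `y + e_i + e_j`, direction `j` first. -/
def dT (i j : Fin 2) (U : GaugeConfig 2 L G) (y : Site 2 L) : G := U (y, j) * U (y.shift j, i)

/-- `C_y(ΘU) = D_{θy}(U)`. -/
theorem cT_configDiagSwap (i j : Fin 2) (U : GaugeConfig 2 L G) (y : Site 2 L) :
    cT i j (configDiagSwap i j U) y = dT i j U (siteDiagSwap i j y) := by
  simp only [cT, dT, configDiagSwap, edgeDiagSwap, siteDiagSwap_shift, Equiv.swap_apply_left,
    Equiv.swap_apply_right]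

/-- `D_y(ΘU) = C_{θy}(U)`. -/
theorem dT_configDiagSwap (i j : Fin 2) (U : GaugeConfig 2 L G) (y : Site 2 L) :
    dT i j (configDiagSwap i j U) y = cT i j U (siteDiagSwap i j y) := by
  simp only [cT, dT, configDiagSwap, edgeDiagSwap, siteDiagSwap_shift, Equiv.swap_apply_left,
    Equiv.swap_apply_right]

variable {N : ℕ} (ρ : G →* Matrix (Fin N) (Fin N) ℂ)

/-- `r_y(U) = Re tr ρ(C_y D_y⁻¹)`, the plaquette term at the site `y`. -/
def rr (i j : Fin 2) (U : GaugeConfig 2 L G) (y : Site 2 L) : ℝ :=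
  ((ρ (cT i j U y * (dT i j U y)⁻¹)).trace).re

/-- In two dimensions the plane label of a plaquette is the unique pair `(0, 1)`. -/
theorem plaq_snd_eq (p : Plaquette 2 L) : p.2 = ⟨(0, 1), by decide⟩ := by
  obtain ⟨y, ⟨⟨a, b⟩, hab⟩⟩ := p
  fin_cases a <;> fin_cases b
  · exact absurd hab (by decide)
  · rfl
  · exact absurd hab (by decide)
  · exact absurd hab (by decide)

/-- The plaquettes of the two-dimensional torus are labelled by their base sites. -/
def plaqEquiv : Plaquette 2 L ≃ Site 2 L where
  toFun p := p.1
  invFun y := (y, ⟨(0, 1), by decide⟩)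
  left_inv p := by
    ext1
    · rfl
    · exact (plaq_snd_eq p).symm
  right_inv _ := rfl

/-- Sums over plaquettes are sums over base sites. -/
theorem sum_plaquette_eq_sum_site {M : Type*} [AddCommMonoid M] [NeZero L] (f : Site 2 L → M) :
    ∑ p : Plaquette 2 L, f p.1 = ∑ y : Site 2 L, f y :=
  Fintype.sum_equiv plaqEquiv _ _ fun _ => rfl

variable [TopologicalSpace G] [IsTopologicalGroup G] [CompactSpace G]

/-- `Re tr ρ(U_p) = r_{p.1}(U)` for every plaquette of the two-dimensional torus and every ordered
pair of distinct directions `(i, j)` (for `(i, j) = (1, 0)` the holonomy is `D C⁻¹ = (C D⁻¹)⁻¹`,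
with the same real trace). -/
theorem plaqRe_eq_rr [NeZero L] (hρ : Continuous ρ) {i j : Fin 2} (hij : i ≠ j)
    (U : GaugeConfig 2 L G) (p : Plaquette 2 L) :
    WilsonRP.plaqRe ρ U p = rr ρ i j U p.1 := by
  rw [WilsonRP.plaqRe, plaq_snd_eq p]
  simp only [plaquetteHolonomy, rr, cT, dT]
  fin_cases i <;> fin_cases j
  · exact absurd rfl hij
  · simp only [Fin.zero_eta, Fin.isValue, Fin.mk_one, mul_inv_rev, mul_assoc]
  · simp only [Fin.mk_one, Fin.isValue, Fin.zero_eta, mul_inv_rev]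
    rw [← CompactGroup.re_trace_map_inv ρ hρ]
    simp only [mul_inv_rev, inv_inv, mul_assoc]
  · exact absurd rfl hij

/-- `r_y(ΘU) = r_{θy}(U)`. -/
theorem rr_configDiagSwap (hρ : Continuous ρ) (i j : Fin 2) (U : GaugeConfig 2 L G)
    (y : Site 2 L) :
    rr ρ i j (configDiagSwap i j U) y = rr ρ i j U (siteDiagSwap i j y) := by
  rw [rr, rr, cT_configDiagSwap, dT_configDiagSwap, ← CompactGroup.re_trace_map_inv ρ hρ,
    mul_inv_rev, inv_inv]

/-- The Wilson action of the two-dimensional torus as a sum over base sites. -/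
theorem wilsonAction_eq_sum_rr [NeZero L] (hρ : Continuous ρ) {i j : Fin 2} (hij : i ≠ j)
    (U : GaugeConfig 2 L G) :
    wilsonAction ρ U = N * Fintype.card (Plaquette 2 L) - ∑ y : Site 2 L, rr ρ i j U y := by
  rw [WilsonRP.wilsonAction_eq, ← sum_plaquette_eq_sum_site]
  simp only [plaqRe_eq_rr ρ hρ hij]

end Transports

/-! ## Arithmetic of the diagonal coordinate on the even torus `L ≥ 4` -/

section Layers

variable {L : ℕ}

/-- The back-layer value `c = L/2` of the diagonal coordinate. -/
def cc (L : ℕ) : ZMod L := ((L / 2 : ℕ) : ZMod L)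

/-- `c` has representative `L/2`. -/
theorem cc_val (h4 : 4 ≤ L) : (cc L).val = L / 2 := by
  rw [cc, ZMod.val_natCast]
  exact Nat.mod_eq_of_lt (by omega)

/-- `c ≠ 0`. -/
theorem cc_ne_zero (h4 : 4 ≤ L) : cc L ≠ 0 := by
  intro h
  have := cc_val h4
  rw [h, ZMod.val_zero] at this
  omega

/-- `-c = c` for even `L`: the back layer is mapped to itself by the swap. -/
theorem neg_cc (hL : Even L) : -cc L = cc L := by
  obtain ⟨r, hr⟩ := hL
  have h2 : cc L + cc L = 0 := by
    rw [cc, ← Nat.cast_add, show L / 2 + L / 2 = L by omega, ZMod.natCast_self]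
  exact neg_eq_of_add_eq_zero_left h2

/-- `1` has representative `1`. -/
theorem val_one_of_four_le (h4 : 4 ≤ L) : (1 : ZMod L).val = 1 := by
  haveI : Fact (1 < L) := ⟨by omega⟩
  exact ZMod.val_one L

/-- `c ≠ 1` (`L ≥ 4`). -/
theorem cc_ne_one (h4 : 4 ≤ L) : cc L ≠ 1 := by
  intro h
  have := cc_val h4
  rw [h, val_one_of_four_le h4] at this
  omega

/-- Representative of `-k` for `k ≠ 0`. -/
theorem val_neg_of_ne_zero' [NeZero L] {k : ZMod L} (hk : k ≠ 0) : (-k).val = L - k.val := by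
  rw [ZMod.neg_val, if_neg hk]

/-- `c ≠ -1` (`L ≥ 4`). -/
theorem cc_ne_neg_one [NeZero L] (h4 : 4 ≤ L) : cc L ≠ -1 := by
  intro h
  have h1 : (1 : ZMod L) ≠ 0 := by
    intro h0
    have := val_one_of_four_le h4
    rw [h0, ZMod.val_zero] at this
    omega
  have := cc_val h4
  rw [h, val_neg_of_ne_zero' h1, val_one_of_four_le h4] at this
  omega

/-- Representative of `k + 1` below the back layer. -/
theorem val_add_one_of_lt (h4 : 4 ≤ L) {k : ZMod L} (hk : k.val < L / 2) :
    (k + 1).val = k.val + 1 := by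
  rw [ZMod.val_add_of_lt, val_one_of_four_le h4]
  rw [val_one_of_four_le h4]
  omega

/-- Representative of `k - 1` above the mirror. -/
theorem val_sub_one_of_pos [NeZero L] (h4 : 4 ≤ L) {k : ZMod L} (hk : 0 < k.val) :
    (k - 1).val = k.val - 1 := by
  rw [ZMod.val_sub, val_one_of_four_le h4]
  rw [val_one_of_four_le h4]
  omega

/-- Membership in the back layer in terms of representatives. -/
theorem kd_eq_cc_iff [NeZero L] (h4 : 4 ≤ L) {i j : Fin 2} (y : Site 2 L) :
    kd i j y = cc L ↔ (kd i j y).val = L / 2 := by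
  rw [← cc_val h4]
  exact ⟨fun h => by rw [h], fun h => ZMod.val_injective L h⟩

/-- Membership in the mirror in terms of representatives. -/
theorem kd_eq_zero_iff {i j : Fin 2} (y : Site 2 L) : kd i j y = 0 ↔ (kd i j y).val = 0 := by
  rw [ZMod.val_eq_zero]

/-- Shifting is injective. -/
theorem shift_injective {d : ℕ} (μ : Fin d) {y y' : Site d L} (h : y.shift μ = y'.shift μ) :
    y = y' :=
  add_right_cancel (b := Pi.single μ (1 : ZMod L)) h

/-- A step moves the site. -/
theorem shift_ne_self (h4 : 4 ≤ L) {d : ℕ} (y : Site d L) (μ : Fin d) : y.shift μ ≠ y := by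
  intro h
  have h1 := congrFun h μ
  rw [WilsonRP.shift_apply_self] at h1
  have h2 : (1 : ZMod L) = 0 := by simpa using h1
  have := val_one_of_four_le h4
  rw [h2, ZMod.val_zero] at this
  omega

end Layers

/-! ## Link blocks of plaquettes and their disjointness -/

section Blocks

variable {L : ℕ}

/-- The four links of the plaquette based at `y`: those of `C_y` and those of `D_y`. -/
def blk (i j : Fin 2) (y : Site 2 L) : Finset (Edge 2 L) :=
  {(y, i), (y.shift i, j), (y, j), (y.shift j, i)}

/-- Membership in a link block. -/
theorem mem_blk {i j : Fin 2} {y : Site 2 L} {e : Edge 2 L} :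
    e ∈ blk i j y ↔ e = (y, i) ∨ e = (y.shift i, j) ∨ e = (y, j) ∨ e = (y.shift j, i) := by
  simp only [blk, Finset.mem_insert, Finset.mem_singleton]

/-- Plaquettes at distinct sites whose diagonal coordinates do not differ by `±1` have disjoint
link blocks. -/
theorem disjoint_blk {i j : Fin 2} (hij : i ≠ j) {y y' : Site 2 L} (hne : y ≠ y')
    (h1 : kd i j y' ≠ kd i j y + 1) (h2 : kd i j y ≠ kd i j y' + 1) :
    Disjoint (blk i j y) (blk i j y') := by
  have hk1 : ∀ z : Site 2 L, kd i j (z.shift i) = kd i j z + 1 := kd_shift_left hij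
  have hk2 : ∀ z : Site 2 L, kd i j (z.shift j) + 1 = kd i j z := fun z => by
    rw [kd_shift_right hij]; ring
  rw [Finset.disjoint_left]
  intro e he he'
  rw [mem_blk] at he he'
  rcases he with rfl | rfl | rfl | rfl <;> rcases he' with h | h | h | h <;>
    simp only [Prod.mk.injEq, hij, hij.symm, and_false, and_true] at h <;>
    first
      | exact hne h
      | exact hne (shift_injective i h)
      | exact hne (shift_injective j h)
      | exact h1 (by rw [h, hk2])
      | exact h1 (by rw [← h, hk1])
      | exact h2 (by rw [h, hk1])
      | exact h2 (by rw [← h, hk2])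

end Blocks

/-! ## The four families of plaquettes: mirror, back layer, and the two interiors -/

section Families

variable {L : ℕ} [NeZero L]

/-- Mirror plaquettes `k = 0`. -/
def S0 (i j : Fin 2) : Finset (Site 2 L) := univ.filter fun y => (kd i j y).val = 0
/-- Back-layer plaquettes `k = L/2`. -/
def Sc (i j : Fin 2) : Finset (Site 2 L) := univ.filter fun y => (kd i j y).val = L / 2
/-- Interior plaquettes of the closed half, `0 < k < L/2`. -/
def Sp (i j : Fin 2) : Finset (Site 2 L) :=
  univ.filter fun y => 0 < (kd i j y).val ∧ (kd i j y).val < L / 2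
/-- Interior plaquettes of the opposite half, `L/2 < k < L`. -/
def Sm (i j : Fin 2) : Finset (Site 2 L) := univ.filter fun y => L / 2 < (kd i j y).val

/-- Membership in `S0`. -/
@[simp] theorem mem_S0 {i j : Fin 2} {y : Site 2 L} : y ∈ S0 i j ↔ (kd i j y).val = 0 := by
  simp [S0]
/-- Membership in `Sc`. -/
@[simp] theorem mem_Sc {i j : Fin 2} {y : Site 2 L} : y ∈ Sc i j ↔ (kd i j y).val = L / 2 := by
  simp [Sc]
/-- Membership in `Sp`. -/
@[simp] theorem mem_Sp {i j : Fin 2} {y : Site 2 L} :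
    y ∈ Sp i j ↔ 0 < (kd i j y).val ∧ (kd i j y).val < L / 2 := by
  simp [Sp]
/-- Membership in `Sm`. -/
@[simp] theorem mem_Sm {i j : Fin 2} {y : Site 2 L} : y ∈ Sm i j ↔ L / 2 < (kd i j y).val := by
  simp [Sm]

/-- The four families partition the plaquettes. -/
theorem sum_split (h4 : 4 ≤ L) (i j : Fin 2) (f : Site 2 L → ℝ) :
    ∑ y, f y = ∑ y ∈ S0 i j, f y + ∑ y ∈ Sc i j, f y + ∑ y ∈ Sp i j, f y + ∑ y ∈ Sm i j, f y := by
  simp only [S0, Sc, Sp, Sm, Finset.sum_filter, ← Finset.sum_add_distrib]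
  refine Finset.sum_congr rfl fun y _ => ?_
  have h4' : 2 ≤ L / 2 := by omega
  split_ifs <;> first | (simp; done) | (exfalso; omega)

/-- The swap carries the interior of the half onto the interior of the opposite half. -/
theorem sum_Sp_swap (hL : Even L) (i j : Fin 2) (f : Site 2 L → ℝ) :
    ∑ y ∈ Sp i j, f (siteDiagSwap i j y) = ∑ y ∈ Sm i j, f y := by
  obtain ⟨r, hr⟩ := hL
  refine Finset.sum_nbij' (siteDiagSwap i j) (siteDiagSwap i j) ?_ ?_
    (fun y _ => siteDiagSwap_siteDiagSwap i j y) (fun y _ => siteDiagSwap_siteDiagSwap i j y)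
    (fun y _ => rfl)
  · intro y hy
    rw [mem_Sp] at hy
    have hlt := ZMod.val_lt (kd i j y)
    have hne : kd i j y ≠ 0 := fun h => by rw [h, ZMod.val_zero] at hy; omega
    rw [mem_Sm, kd_siteDiagSwap, val_neg_of_ne_zero' hne]
    omega
  · intro y hy
    rw [mem_Sm] at hy
    have hlt := ZMod.val_lt (kd i j y)
    have hne : kd i j y ≠ 0 := fun h => by rw [h, ZMod.val_zero] at hy; omega
    rw [mem_Sp, kd_siteDiagSwap, val_neg_of_ne_zero' hne]
    omega

/-- A link is a link of the CLOSED DIAGONAL HALF `{0 ≤ (y_i - y_j) mod L ≤ L/2}` if both its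
endpoints lie in it (the support condition of `IsDiagonalHalfObservable`). [shape] A parametric
definition of a proposition — NOT a fact. [folklore] -/
def InHalf (i j : Fin 2) (e : Edge 2 L) : Prop :=
  (kd i j e.1).val ≤ L / 2 ∧ (kd i j (e.1.shift e.2)).val ≤ L / 2

/-- The two links of `D_y` for `y` in the back layer are links of the closed half. -/
theorem inHalf_dT_links (h4 : 4 ≤ L) {i j : Fin 2} (hij : i ≠ j) {y : Site 2 L}
    (hy : kd i j y = cc L) : InHalf i j (y, j) ∧ InHalf i j (y.shift j, i) := by
  have hv : (kd i j y).val = L / 2 := by rw [hy, cc_val h4]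
  have hv1 : (kd i j (y.shift j)).val = L / 2 - 1 := by
    rw [kd_shift_right hij, val_sub_one_of_pos h4 (by omega), hv]
  have hv2 : kd i j ((y.shift j).shift i) = kd i j y := by
    rw [kd_shift_left hij, kd_shift_right hij]; ring
  refine ⟨⟨by simp only [hv]; exact le_rfl, by simp only [hv1]; omega⟩,
    ⟨by simp only [hv1]; omega, by simp only [hv2, hv]; exact le_rfl⟩⟩

/-- The four links of an interior plaquette of the half are links of the closed half. -/
theorem inHalf_blk (h4 : 4 ≤ L) {i j : Fin 2} (hij : i ≠ j) {y : Site 2 L} (hy : y ∈ Sp i j)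
    {e : Edge 2 L} (he : e ∈ blk i j y) : InHalf i j e := by
  rw [mem_Sp] at hy
  have hvi : (kd i j (y.shift i)).val = (kd i j y).val + 1 := by
    rw [kd_shift_left hij, val_add_one_of_lt h4 hy.2]
  have hvj : (kd i j (y.shift j)).val = (kd i j y).val - 1 := by
    rw [kd_shift_right hij, val_sub_one_of_pos h4 hy.1]
  have hij' : kd i j ((y.shift i).shift j) = kd i j y := by
    rw [kd_shift_right hij, kd_shift_left hij]; ring
  have hji' : kd i j ((y.shift j).shift i) = kd i j y := by
    rw [kd_shift_left hij, kd_shift_right hij]; ring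
  rw [mem_blk] at he
  rcases he with rfl | rfl | rfl | rfl <;> constructor <;>
    simp only [hvi, hvj, hij', hji'] <;> omega

end Families

end DiagRPTwo

end

end Summit.QuantumFields.GaugeBoot
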